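import Mathlib
import Summits.ValiantsHypothesis.ValiantsHypothesis.Theses.NewtonUnitEquations
import Summits.ValiantsHypothesis.ValiantsHypothesis.Theorems.NewtonUnitEquationsDissociatedUniformOfKLetterFrame
import Summits.ValiantsHypothesis.ValiantsHypothesis.Theorems.NewtonUnitEquationsDissociatedUniformQuasiPoly
import Summits.ValiantsHypothesis.ValiantsHypothesis.Theorems.NewtonUnitEquationsDissociatedUniformStubCellDecomposition
import Summits.ValiantsHypothesis.ValiantsHypothesis.Theorems.NewtonUnitEquationsDissociatedUniformStubColoredNovelty
import Summits.ValiantsHypothesis.ValiantsHypothesis.Theorems.NewtonUnitEquationsDissociatedUniformStubTorusDepth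
import Summits.ValiantsHypothesis.ValiantsHypothesis.Theorems.NewtonUnitEquationsDissociatedUniformStubTorusCrossNovelty
import Summits.ValiantsHypothesis.ValiantsHypothesis.Theorems.NewtonUnitEquationsDissociatedUniformStubSubframeCount
import Summits.ValiantsHypothesis.ValiantsHypothesis.Theorems.NewtonUnitEquationsDissociatedUniformTorusLogK
import Summits.ValiantsHypothesis.ValiantsHypothesis.Theorems.NewtonUnitEquationsDissociatedUniformStubGoodProduct
import Summits.ValiantsHypothesis.ValiantsHypothesis.Theorems.NewtonUnitEquationsDissociatedUniformStubZerosDepth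
import Summits.ValiantsHypothesis.ValiantsHypothesis.Theorems.NewtonUnitEquationsDissociatedUniformStubZerosCrossNovelty
import Summits.ValiantsHypothesis.ValiantsHypothesis.Theorems.NewtonUnitEquationsDissociatedUniformStubSubframeCountFilter
import Summits.ValiantsHypothesis.ValiantsHypothesis.Theorems.NewtonUnitEquationsDissociatedUniformStubSubframeShadow
import Summits.ValiantsHypothesis.ValiantsHypothesis.Theorems.NewtonUnitEquationsDissociatedUniformZerosLogK

/-!
# Crux `NewtonUnitEquations.DissociatedUniform` (stmt-ValiantsHypothesis-5905) — line `greedy-basis-shadow`,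
# skeleton v5 (lead c7: v4 cells + the zero strata resolved ⇒ `PerCellBound` derived from the m-free kernel `stub_smallShadow`, the one sorry left)

State inherited from lead -0 (all in the tree): stubs A `stub_exposedGenericDirection` (p83658), B `stub_topSurvivorGreedy`
(p80908), B2 `stub_coeffFormula` (p84831), C'' `stub_coveringFamily` (p82998), the composition / alphabet reduction
`dissociatedUniform_of_kLetterFrame` (p88821) and Theorem Q (p94717, with the frame shadow `QuasiPoly.fshadow`, the
lex-greedy sets `QuasiPoly.gE`, the chart decomposition `QuasiPoly.ncard_cshadow_le_charts` and "vertices are shadow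
points" `QuasiPoly.extremePoints_subset_image_fshadow`).

v4 RESHAPE (lead -1).  The one open stub of v3, `stub_kLetterFrame` (= the crux at `t := k`), is split along the CELL
DECOMPOSITION of a chart: along the pencil of heights `a ↦ ε·X(a) + λ·Y(a)` (`ε = ±1`, `λ ∈ ℝ`) the real line of
parameters `λ` splits at the ≤ `(m·k²)²` roots of the affine "pair-of-pairs" letter comparisons
`(ε X + λ Y)(l₁) − (ε X + λ Y)(l₂) − (ε X + λ Y)(l₃) + (ε X + λ Y)(l₄)` (`l₁,l₂ ∈ A j`, `l₃,l₄ ∈ A j'`) into CELLS on which every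
such comparison has constant sign — i.e. on a cell the top letter of every coordinate and the linear (pre)order of all
demotion weights `h(top_j) − h(l)` are frozen, and all word heights are affine in `λ`.
* `stub_cellDecomposition` (TRUE, bookkeeping; lead -1 proves it): if every cell shadow (greedy words met at injective
  parameters of one cell) has `≤ Q` words then `|fshadow A f| ≤ 2(((m k²)²+1)·Q + (m k²)²·k) + 2k + 1`.
* `stub_perCellBound` (OPEN, hardest = the crux localised to a rigid-order cell): a cell shadow has `≤ (k·m·k+2)^P` words.
  Inside a cell every greedy word is GALE-GREEDY for the frozen order (lead -1 notes §M2), exchanges happen only at ties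
  of two Gale candidates and each pair ties at most once (affine heights), so the stub holds whenever the number of Gale
  candidates is polynomial — true for coefficient families in general position (uniform matroid: `≤ e·k²` candidates), false
  as a METHOD for character designs (Gale-minimal representations can number `exp(c√q)`), where the stub is the
  rigid-order form of Conjecture K; all exact data (lead -1 kit/) are linear in `k·m`.
Composition: vertices ⊆ image of `fshadow` (Theorem Q's §E) and arithmetic give `stub_kLetterFrame`'s statement
(`kLetterFrame_of_cells`), whence the crux by `dissociatedUniform_of_kLetterFrame`.
-/

-- `Summit.ValiantsHypothesis.ValiantsHypothesis.…` is the tree's mandated single-conjunct layout (Sub = Summit).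
set_option linter.dupNamespace false

namespace Summit.ValiantsHypothesis.ValiantsHypothesis.Cruxes.DissociatedUniform.GreedyBasisShadow

open scoped BigOperators
open Summit.ValiantsHypothesis.ValiantsHypothesis.Theorems.NewtonUnitEquationsDissociatedUniform

/-- Registered stub E1 = `CellDecomposition` — CLOSED: it is the tree theorem
`…Theorems.NewtonUnitEquationsDissociatedUniform.stub_cellDecomposition` (p100756, lead -1; independently re-proved by
lead c2's worker, `work/stubs/StubCellDecomposition.lean`, not proposed because the target is append-only): a uniform bound `Q`
on the cell shadows of both charts bounds the frame shadow by `2(((m·k²)² + 1)·Q + (m·k²)²·k) + 2k + 1`. -/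
theorem stub_cellDecomposition :
    ∀ (k m Q : ℕ) (A : Fin m → Finset (Fin 2 →₀ ℕ)) (f : Fin k → Fin m → MvPolynomial (Fin 2) ℂ),
      (∀ j, (A j).card ≤ k) →
      (∀ (ε : ℝ) (Λ : Set ℝ), (ε = 1 ∨ ε = -1) →
        (∀ (j j' : Fin m), ∀ l₁ ∈ A j, ∀ l₂ ∈ A j, ∀ l₃ ∈ A j', ∀ l₄ ∈ A j', ∀ lam ∈ Λ, ∀ lam' ∈ Λ,
          ((ε * ((((l₁ 0 : ℕ) : ℝ)) - (((l₂ 0 : ℕ) : ℝ)) - (((l₃ 0 : ℕ) : ℝ)) + (((l₄ 0 : ℕ) : ℝ))) +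
              lam * ((((l₁ 1 : ℕ) : ℝ)) - (((l₂ 1 : ℕ) : ℝ)) - (((l₃ 1 : ℕ) : ℝ)) + (((l₄ 1 : ℕ) : ℝ))) < 0 ↔
            ε * ((((l₁ 0 : ℕ) : ℝ)) - (((l₂ 0 : ℕ) : ℝ)) - (((l₃ 0 : ℕ) : ℝ)) + (((l₄ 0 : ℕ) : ℝ))) +
              lam' * ((((l₁ 1 : ℕ) : ℝ)) - (((l₂ 1 : ℕ) : ℝ)) - (((l₃ 1 : ℕ) : ℝ)) + (((l₄ 1 : ℕ) : ℝ))) < 0) ∧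
          (0 < ε * ((((l₁ 0 : ℕ) : ℝ)) - (((l₂ 0 : ℕ) : ℝ)) - (((l₃ 0 : ℕ) : ℝ)) + (((l₄ 0 : ℕ) : ℝ))) +
              lam * ((((l₁ 1 : ℕ) : ℝ)) - (((l₂ 1 : ℕ) : ℝ)) - (((l₃ 1 : ℕ) : ℝ)) + (((l₄ 1 : ℕ) : ℝ))) ↔
            0 < ε * ((((l₁ 0 : ℕ) : ℝ)) - (((l₂ 0 : ℕ) : ℝ)) - (((l₃ 0 : ℕ) : ℝ)) + (((l₄ 0 : ℕ) : ℝ))) +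
              lam' * ((((l₁ 1 : ℕ) : ℝ)) - (((l₂ 1 : ℕ) : ℝ)) - (((l₃ 1 : ℕ) : ℝ)) + (((l₄ 1 : ℕ) : ℝ)))))) →
        {a : Fin m → (Fin 2 →₀ ℕ) | ∃ lam ∈ Λ,
            Set.InjOn (fun a : Fin m → (Fin 2 →₀ ℕ) => ε * QuasiPoly.Xf a + lam * QuasiPoly.Yf a) (Fintype.piFinset A) ∧
            a ∈ QuasiPoly.gE (Fintype.piFinset A) (QuasiPoly.col f)
              (fun a : Fin m → (Fin 2 →₀ ℕ) => ε * QuasiPoly.Xf a + lam * QuasiPoly.Yf a)}.ncard ≤ Q) →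
      (QuasiPoly.fshadow A f).ncard ≤ 2 * (((m * k ^ 2) ^ 2 + 1) * Q + (m * k ^ 2) ^ 2 * k) + k + k + 1 :=
  Summit.ValiantsHypothesis.ValiantsHypothesis.Theorems.NewtonUnitEquationsDissociatedUniform.stub_cellDecomposition

/-! ### v5 RESHAPE (lead c7): `PerCellBound` ⟸ `SmallShadow(k)` — the coordinate number `m` is eliminated

By the ZERO-STRATA theorems of this seat (section `ZerosLogK` below; all landed), the greedy words of a cell of an
ARBITRARY frame (any `m`, zeros allowed) split into `k` classes (GOOD product `i`, Lemma Z) and class `i` embeds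
injectively into the frame shadow of a sub-frame with `≤ 4k²` coordinates and `≤ 4k² + 1` letters per coordinate
(doubled colored pool + `stub_subframeShadow`).  Hence `stub_perCellBound` (per-cell count `≤ (k·m·k+2)^P` for
`k`-letter frames) FOLLOWS from a bound for SMALL frames, uniformly in `m`:
* `stub_smallShadow` (OPEN — THE KERNEL, registered): every `k`-product frame on `n ≤ 4k²` coordinates with
  `≤ 4k² + 1` letters per coordinate has `|fshadow| ≤ (k+2)^P`.  (Theorem Q gives `(4k²+3)(8(k+2)³)^⌈log₂ 4k²⌉ =
  k^O(log k)`, whence the landed `zeros_logK`: exponent `O(log k)` for all frames; `poly(k)` is exactly the design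
  kernel — Conjecture K in rigid-order form lives inside, `k = q` characters on `4q² ≥ (q−1)²` items = Theorem R's
  kernel.)  No dissociation / alphabet-size / support hypothesis is needed or used: the shadow only sees injective
  chart directions.
* `stub_perCellBound` is now DERIVED (`perCellBound_of_smallShadow`), so the skeleton reads
  `DissociatedUniform ⟸ SmallShadow` with everything else a tree theorem.
-/

/-- Registered stub K = `SmallShadow` (OPEN — THE KERNEL of the crux after the v5 reshape): there is an absolute `P`
such that every `k`-product frame on `n ≤ 4k²` coordinates with at most `4k² + 1` letters per coordinate has frame
shadow (`QuasiPoly.fshadow` = the words that are lex-greedy for some injective chart height) of size `≤ (k + 2)^P`.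
Known: `≤ (4k²+3)(8(k+2)³)^⌈log₂ 4k²⌉` (Theorem Q, `QuasiPoly.ncard_fshadow_le`); `poly(k)` on the general-position
stratum (c5); the statement contains the rigid-order Conjecture K (character designs, `k = q`). -/
theorem stub_smallShadow :
    ∃ P : ℕ, ∀ (k n : ℕ) (A : Fin n → Finset (Fin 2 →₀ ℕ)) (f : Fin k → Fin n → MvPolynomial (Fin 2) ℂ),
      n ≤ 4 * k ^ 2 → (∀ j, (A j).card ≤ 4 * k ^ 2 + 1) → (QuasiPoly.fshadow A f).ncard ≤ (k + 2) ^ P := by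
  sorry

/-- Arithmetic of the reshape: `k·(k+2)^P ≤ (k·m·k + 2)^(P+1)` once `m ≥ 1`. -/
theorem smallShadow_arith (k m P : ℕ) (hm : 1 ≤ m) : k * (k + 2) ^ P ≤ (k * m * k + 2) ^ (P + 1) := by
  have hk2 : k + 2 ≤ k * m * k + 2 := by
    have : k ≤ k * m * k := by
      rcases Nat.eq_zero_or_pos k with rfl | hk
      · simp
      · calc k = 1 * 1 * k := by ring
          _ ≤ k * m * k := Nat.mul_le_mul (Nat.mul_le_mul hk hm) le_rfl
    omega
  have hk : k ≤ k * m * k + 2 := by omega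
  calc k * (k + 2) ^ P ≤ (k * m * k + 2) * (k * m * k + 2) ^ P :=
        Nat.mul_le_mul hk (Nat.pow_le_pow_left hk2 P)
    _ = (k * m * k + 2) ^ (P + 1) := by ring

/-- Registered stub E2 = `PerCellBound` — now DERIVED from the kernel stub `stub_smallShadow` through the landed
per-cell kernel reduction `zeros_perCell_of_bound` (Lemma Z + doubled colored pool + sub-frame shadow embedding):
on a `k`-letter dissociated frame, the greedy words met at the injective parameters of ONE cell of a chart number
at most `(k·m·k + 2)^P`.  (The hypotheses `|A j| ≤ k`, supports, dissociation and `ε = ±1` are no longer used.) -/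
theorem stub_perCellBound :
    ∃ P : ℕ, ∀ (k m : ℕ) (A : Fin m → Finset (Fin 2 →₀ ℕ)) (f : Fin k → Fin m → MvPolynomial (Fin 2) ℂ),
      (∀ j, (A j).card ≤ k) → (∀ i j, (f i j).support ⊆ A j) →
      (∀ a b : Fin m → (Fin 2 →₀ ℕ), (∀ j, a j ∈ A j) → (∀ j, b j ∈ A j) → ∑ j, a j = ∑ j, b j → a = b) →
      ∀ (ε : ℝ) (Λ : Set ℝ), (ε = 1 ∨ ε = -1) →
        (∀ (j j' : Fin m), ∀ l₁ ∈ A j, ∀ l₂ ∈ A j, ∀ l₃ ∈ A j', ∀ l₄ ∈ A j', ∀ lam ∈ Λ, ∀ lam' ∈ Λ,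
          ((ε * ((((l₁ 0 : ℕ) : ℝ)) - (((l₂ 0 : ℕ) : ℝ)) - (((l₃ 0 : ℕ) : ℝ)) + (((l₄ 0 : ℕ) : ℝ))) +
              lam * ((((l₁ 1 : ℕ) : ℝ)) - (((l₂ 1 : ℕ) : ℝ)) - (((l₃ 1 : ℕ) : ℝ)) + (((l₄ 1 : ℕ) : ℝ))) < 0 ↔
            ε * ((((l₁ 0 : ℕ) : ℝ)) - (((l₂ 0 : ℕ) : ℝ)) - (((l₃ 0 : ℕ) : ℝ)) + (((l₄ 0 : ℕ) : ℝ))) +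
              lam' * ((((l₁ 1 : ℕ) : ℝ)) - (((l₂ 1 : ℕ) : ℝ)) - (((l₃ 1 : ℕ) : ℝ)) + (((l₄ 1 : ℕ) : ℝ))) < 0) ∧
          (0 < ε * ((((l₁ 0 : ℕ) : ℝ)) - (((l₂ 0 : ℕ) : ℝ)) - (((l₃ 0 : ℕ) : ℝ)) + (((l₄ 0 : ℕ) : ℝ))) +
              lam * ((((l₁ 1 : ℕ) : ℝ)) - (((l₂ 1 : ℕ) : ℝ)) - (((l₃ 1 : ℕ) : ℝ)) + (((l₄ 1 : ℕ) : ℝ))) ↔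
            0 < ε * ((((l₁ 0 : ℕ) : ℝ)) - (((l₂ 0 : ℕ) : ℝ)) - (((l₃ 0 : ℕ) : ℝ)) + (((l₄ 0 : ℕ) : ℝ))) +
              lam' * ((((l₁ 1 : ℕ) : ℝ)) - (((l₂ 1 : ℕ) : ℝ)) - (((l₃ 1 : ℕ) : ℝ)) + (((l₄ 1 : ℕ) : ℝ)))))) →
        {a : Fin m → (Fin 2 →₀ ℕ) | ∃ lam ∈ Λ,
            Set.InjOn (fun a : Fin m → (Fin 2 →₀ ℕ) => ε * QuasiPoly.Xf a + lam * QuasiPoly.Yf a) (Fintype.piFinset A) ∧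
            a ∈ QuasiPoly.gE (Fintype.piFinset A) (QuasiPoly.col f)
              (fun a : Fin m → (Fin 2 →₀ ℕ) => ε * QuasiPoly.Xf a + lam * QuasiPoly.Yf a)}.ncard ≤ (k * m * k + 2) ^ P := by
  classical
  obtain ⟨P, hP⟩ := stub_smallShadow
  refine ⟨P + 1, fun k m A f _ _ _ ε Λ _ hcell => ?_⟩
  rcases Nat.eq_zero_or_pos m with hm | hm
  · -- `m = 0`: the box is a single word
    subst hm
    calc _ ≤ ((Fintype.piFinset A : Finset (Fin 0 → (Fin 2 →₀ ℕ))) : Set (Fin 0 → (Fin 2 →₀ ℕ))).ncard :=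
          Set.ncard_le_ncard (fun a ha => by
            obtain ⟨lam, -, -, ha⟩ := ha
            exact ha.1) (Finset.finite_toSet _)
      _ ≤ 1 := by
          rw [Set.ncard_coe_finset, Fintype.card_piFinset]
          simp
      _ ≤ (k * 0 * k + 2) ^ (P + 1) := Nat.one_le_pow _ _ (by omega)
  · have h := Summit.ValiantsHypothesis.ValiantsHypothesis.Theorems.NewtonUnitEquationsDissociatedUniform.zeros_perCell_of_bound k m ((k + 2) ^ P) A f ε Λ
      (fun n hn A' f' hA' => hP k n A' f' hn hA') hcell
    exact h.trans (smallShadow_arith k m P hm)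

/-- Elementary arithmetic of the composition: with `B = k·m·k + 2` and `k ≤ B` (true once `m ≥ 1`), the
cell-decomposition bound with `Q = B^P` is at most `B^(P+6)`. -/
theorem cells_arith (k m P : ℕ) (hk : k ≤ k * m * k + 2) :
    2 * (((m * k ^ 2) ^ 2 + 1) * (k * m * k + 2) ^ P + (m * k ^ 2) ^ 2 * k) + k + k + 1 ≤ (k * m * k + 2) ^ (P + 6) := by
  set B := k * m * k + 2 with hB
  have hB2 : 2 ≤ B := by omega
  have hN : m * k ^ 2 ≤ B := by
    have : m * k ^ 2 = k * m * k := by ring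
    omega
  have hBP : 1 ≤ B ^ P := Nat.one_le_pow _ _ (by omega)
  have hN2 : (m * k ^ 2) ^ 2 ≤ B ^ 2 := Nat.pow_le_pow_left hN 2
  have hB22 : 4 ≤ B ^ 2 := by nlinarith
  calc 2 * (((m * k ^ 2) ^ 2 + 1) * B ^ P + (m * k ^ 2) ^ 2 * k) + k + k + 1
      ≤ 2 * ((B ^ 2 + 1) * B ^ P + B ^ 2 * B) + B + B + B := by gcongr; omega
    _ = 2 * B ^ (P + 2) + 2 * B ^ P + 2 * B ^ 3 + 3 * B := by ring
    _ ≤ B * B ^ (P + 2) + (B ^ 2 * B) * B ^ P + (B * B ^ P) * B ^ 3 + (B ^ 2 * B ^ P) * B := by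
        have h1 : 2 * B ^ (P + 2) ≤ B * B ^ (P + 2) := Nat.mul_le_mul_right _ hB2
        have h2 : 2 * B ^ P ≤ (B ^ 2 * B) * B ^ P := Nat.mul_le_mul_right _ (by nlinarith)
        have h3 : 2 * B ^ 3 ≤ (B * B ^ P) * B ^ 3 := Nat.mul_le_mul_right _ (by nlinarith)
        have h4 : 3 * B ≤ (B ^ 2 * B ^ P) * B := Nat.mul_le_mul_right _ (by nlinarith)
        omega
    _ = 3 * B ^ (P + 3) + B ^ (P + 4) := by ring
    _ ≤ (2 * B) * B ^ (P + 3) + B ^ (P + 4) := by gcongr; omega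
    _ = 3 * B ^ (P + 4) := by ring
    _ ≤ B ^ 2 * B ^ (P + 4) := by gcongr; omega
    _ = (k * m * k + 2) ^ (P + 6) := by rw [hB]; ring

/-- **Composition (v4).**  `CellDecomposition` + `PerCellBound` give `stub_kLetterFrame`'s statement: on `k`-letter
dissociated frames the Newton polygon of `Σ_i Π_j f_ij` has at most `(k·m·k + 2)^(P+6)` vertices. -/
theorem kLetterFrame_of_cells :
    ∃ C : ℕ, ∀ (k m : ℕ) (A : Fin m → Finset (Fin 2 →₀ ℕ)) (f : Fin k → Fin m → MvPolynomial (Fin 2) ℂ),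
      (∀ j, (A j).card ≤ k) → (∀ i j, (f i j).support ⊆ A j) →
      (∀ a b : Fin m → (Fin 2 →₀ ℕ), (∀ j, a j ∈ A j) → (∀ j, b j ∈ A j) → ∑ j, a j = ∑ j, b j → a = b) →
      (Set.extremePoints ℝ (convexHull ℝ ((fun e : Fin 2 →₀ ℕ => fun i : Fin 2 => ((e i : ℕ) : ℝ)) ''
        ((∑ i, ∏ j, f i j).support : Set (Fin 2 →₀ ℕ))))).ncard ≤ (k * m * k + 2) ^ C := by
  obtain ⟨P, hP⟩ := stub_perCellBound
  refine ⟨P + 6, fun k m A f hcard hsupp hdis => ?_⟩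
  have hvert : (Set.extremePoints ℝ (convexHull ℝ ((fun e : Fin 2 →₀ ℕ => fun i : Fin 2 => ((e i : ℕ) : ℝ)) ''
        ((∑ i, ∏ j, f i j).support : Set (Fin 2 →₀ ℕ))))).ncard ≤ (QuasiPoly.fshadow A f).ncard :=
    calc (Set.extremePoints ℝ (convexHull ℝ ((fun e : Fin 2 →₀ ℕ => fun i : Fin 2 => ((e i : ℕ) : ℝ)) ''
          ((∑ i, ∏ j, f i j).support : Set (Fin 2 →₀ ℕ))))).ncard
        ≤ ((fun a : Fin m → (Fin 2 →₀ ℕ) => fun i : Fin 2 => (((∑ j, a j) i : ℕ) : ℝ)) '' QuasiPoly.fshadow A f).ncard :=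
          Set.ncard_le_ncard (QuasiPoly.extremePoints_subset_image_fshadow A f hsupp hdis)
            ((QuasiPoly.cshadow_finite _ _ _ _).image _)
      _ ≤ (QuasiPoly.fshadow A f).ncard := Set.ncard_image_le (QuasiPoly.cshadow_finite _ _ _ _)
  rcases Nat.eq_zero_or_pos m with hm | hm
  · -- `m = 0`: the box is a single word
    subst hm
    have h1 : (QuasiPoly.fshadow A f).ncard ≤ k ^ 0 := QuasiPoly.ncard_fshadow_le_pow k A f hcard
    calc _ ≤ (QuasiPoly.fshadow A f).ncard := hvert
      _ ≤ 1 := by simpa using h1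
      _ ≤ (k * 0 * k + 2) ^ (P + 6) := Nat.one_le_pow _ _ (by omega)
  · have hk : k ≤ k * m * k + 2 := by
      rcases Nat.eq_zero_or_pos k with hk0 | hk0
      · omega
      · have : k * 1 * 1 ≤ k * m * k := by gcongr <;> omega
        omega
    have hshadow : (QuasiPoly.fshadow A f).ncard ≤
        2 * (((m * k ^ 2) ^ 2 + 1) * (k * m * k + 2) ^ P + (m * k ^ 2) ^ 2 * k) + k + k + 1 :=
      stub_cellDecomposition k m ((k * m * k + 2) ^ P) A f hcard
        (fun ε Λ hε hcell => hP k m A f hcard hsupp hdis ε Λ hε hcell)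
    exact hvert.trans (hshadow.trans (cells_arith k m P hk))

/-- v3's registered stub D'' = `KLetterFrame` (VERBATIM the crux `DissociatedUniform` at `t := k`), now DERIVED from the
two v4 stubs. -/
theorem stub_kLetterFrame :
    ∃ C : ℕ, ∀ (k m : ℕ) (A : Fin m → Finset (Fin 2 →₀ ℕ)) (f : Fin k → Fin m → MvPolynomial (Fin 2) ℂ),
      (∀ j, (A j).card ≤ k) → (∀ i j, (f i j).support ⊆ A j) →
      (∀ a b : Fin m → (Fin 2 →₀ ℕ), (∀ j, a j ∈ A j) → (∀ j, b j ∈ A j) → ∑ j, a j = ∑ j, b j → a = b) →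
      (Set.extremePoints ℝ (convexHull ℝ ((fun e : Fin 2 →₀ ℕ => fun i : Fin 2 => ((e i : ℕ) : ℝ)) ''
        ((∑ i, ∏ j, f i j).support : Set (Fin 2 →₀ ℕ))))).ncard ≤ (k * m * k + 2) ^ C :=
  kLetterFrame_of_cells

/-- **Skeleton**: `NewtonUnitEquations.DissociatedUniform` (stmt-ValiantsHypothesis-5905) from the registered stubs
`stub_cellDecomposition` (E1) and `stub_perCellBound` (E2) through `kLetterFrame_of_cells` and the landed alphabet
reduction `dissociatedUniform_of_kLetterFrame`.  The only theorem of this file whose conclusion is the route decl. -/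
theorem DissociatedUniform_of :
    Summit.ValiantsHypothesis.ValiantsHypothesis.Theses.NewtonUnitEquations.DissociatedUniform :=
  Summit.ValiantsHypothesis.ValiantsHypothesis.Theorems.NewtonUnitEquationsDissociatedUniform.dissociatedUniform_of_kLetterFrame
    stub_kLetterFrame


/-! ## By-product (lead c6): the TORUS STRATUM has exponent `O(log k)` — `m` reduces to `≤ k²` coordinates per cell

For frames whose coefficients have NO structural zeros on the alphabet (`coeff l (f i j) ≠ 0` for all `l ∈ A j`;
designs and general-position tensors are both of this kind) every greedy word of a cell demotes only letters from a
POOL of at most `(k-1)·k` (coordinate, letter) pairs, the same pool for the whole cell.  Mechanism: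
(i) depth: a greedy word differs from the cell's top word in `≤ k - 1` coordinates (annihilating product functional,
tree `DissociatedFixedK.thickness_of_annihilator`); (ii) cross-novelty: the coefficient-ratio vector `ψ (j, a j)` of a
demotion used by a greedy word `a` is not in the span of the ratio vectors of the CHEAPER demotions on coordinates where
`a` is at the top (or on `j` itself); (iii) COLORED NOVELTY LEMMA (new, elementary): in any weighted sequence of vectors
of `ℂ^k` colored by coordinates, the elements that become span-novel after deleting at most `s` color classes (other
than their own) number at most `(s+1)·k` — lift `ψ d ↦ ψ d ⊗ (1, α_c, …, α_c^s)` (`c` = color of `d`, `α` injective):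
pool elements lift to a span-novel (hence linearly independent) family in `ℂ^(k(s+1))`, because a relation among the
lifts, hit with the polynomial vanishing exactly on the deleted colors, becomes a relation avoiding those colors.
Hence the cell's greedy words embed into the frame shadow of a sub-frame with `≤ k²` coordinates and `≤ k² + 2`
letters, which Theorem Q bounds by `(k²+3)(8(k+2)³)^⌈log₂ k²⌉`; with the cell decomposition this gives
`#vert ≤ poly(m, t) · k^O(log k)` on torus frames, i.e. the crux's exponent may be taken `O(log k)`
instead of Theorem Q's `O(log m)` there — polynomial in `(m, t)` for `k ≤ 2^O(√log m)`.  ALL LANDED: stubs T1–T4 below and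
the assembly `Theorems/NewtonUnitEquationsDissociatedUniformTorusLogKCell.lean` (`torus_perCell`, p134728) +
`…TorusLogK.lean` (`torus_logK`, `torus_logK_cruxShape`: `#vert ≤ (k·m·t+2)^(20⌈log₂ k⌉+9)` on torus frames).
-/

section TorusLogK

/-- Registered stub T1 = `ColoredNovelty` — CLOSED (tree theorem `stub_coloredNovelty`, p133594, worker of lead c6). Abstract linear algebra, the new lemma: in a finite family of vectors of
`ℂ^k` with injective weights and colors, the elements that are span-novel with respect to the LIGHTER elements after
deleting at most `s` color classes other than their own number at most `(s + 1)·k`.  (`α` = any injection of the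
colors into `ℂ`, used for the Vandermonde lift `v d ⊗ (1, α c, …, (α c)^s)`.) -/
theorem stub_coloredNovelty (δ κ : Type) (k s : ℕ) (Dm : Finset δ) (v : δ → Fin k → ℂ) (w : δ → ℝ)
    (col : δ → κ) (α : κ → ℂ) (hα : Function.Injective α) (hw : Set.InjOn w Dm) :
    {d : δ | d ∈ Dm ∧ ∃ J : Finset κ, J.card ≤ s ∧ col d ∉ J ∧
      v d ∉ Submodule.span ℂ (v '' {d' : δ | d' ∈ Dm ∧ w d' < w d ∧ col d' ∉ J})}.ncard ≤ (s + 1) * k :=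
  Summit.ValiantsHypothesis.ValiantsHypothesis.Theorems.NewtonUnitEquationsDissociatedUniform.stub_coloredNovelty
    δ κ k s Dm v w col α hα hw

/-- Registered stub T2 = `TorusDepth` — CLOSED (tree theorem `stub_torusDepth`, p133800): on a torus frame (no coefficient of a letter of the alphabet vanishes), a word
that is lex-greedy for an injective chart height differs from the letterwise top word `τ` in at most `k - 1`
coordinates (the annihilating product functional of `DissociatedFixedK.thickness_of_annihilator`, fed with a linear
functional separating `col f a` from the span of the higher columns; torus ⇒ its trichotomy hypothesis). -/
theorem stub_torusDepth (k m : ℕ) (A : Fin m → Finset (Fin 2 →₀ ℕ)) (f : Fin k → Fin m → MvPolynomial (Fin 2) ℂ)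
    (ε lam : ℝ) (τ a : Fin m → (Fin 2 →₀ ℕ))
    (htorus : ∀ i j, ∀ l ∈ A j, (f i j).coeff l ≠ 0) (hτA : ∀ j, τ j ∈ A j)
    (hτ : ∀ j, ∀ l ∈ A j, ε * ((l 0 : ℕ) : ℝ) + lam * ((l 1 : ℕ) : ℝ) ≤ ε * ((τ j 0 : ℕ) : ℝ) + lam * ((τ j 1 : ℕ) : ℝ))
    (hinj : Set.InjOn (fun b : Fin m → (Fin 2 →₀ ℕ) => ε * QuasiPoly.Xf b + lam * QuasiPoly.Yf b) (Fintype.piFinset A))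
    (ha : a ∈ QuasiPoly.gE (Fintype.piFinset A) (QuasiPoly.col f)
      (fun b : Fin m → (Fin 2 →₀ ℕ) => ε * QuasiPoly.Xf b + lam * QuasiPoly.Yf b)) :
    (Finset.univ.filter fun j => a j ≠ τ j).card + 1 ≤ k :=
  Summit.ValiantsHypothesis.ValiantsHypothesis.Theorems.NewtonUnitEquationsDissociatedUniform.stub_torusDepth
    k m A f ε lam τ a htorus hτA hτ hinj ha

/-- Registered stub T3 = `TorusCrossNovelty` — CLOSED (tree theorem `stub_torusCrossNovelty`, p134146): on a torus frame, if the greedy word `a` demotes coordinate `j`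
(`a j ≠ τ j`), then the coefficient-ratio vector of the demotion `(j, a j)` is not in the span of the ratio vectors of
the demotions `d' = (j', l')` (`l' ∈ A j'`, `l' ≠ τ j'`) that are LIGHTER than `(j, a j)` and sit on `j` itself or on
a coordinate where `a` is at the top: each such `d'` gives the higher word `a[j ↦ τ j][j' ↦ l']`, whose column is
`col f a ⊙ ψ d' ⊘ ψ (j, a j)`, so a relation among the `ψ` would put `col f a` in the span of higher columns. -/
theorem stub_torusCrossNovelty (k m : ℕ) (A : Fin m → Finset (Fin 2 →₀ ℕ))
    (f : Fin k → Fin m → MvPolynomial (Fin 2) ℂ) (ε lam : ℝ) (τ a : Fin m → (Fin 2 →₀ ℕ)) (j : Fin m)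
    (htorus : ∀ i j, ∀ l ∈ A j, (f i j).coeff l ≠ 0) (hτA : ∀ j, τ j ∈ A j)
    (ha : a ∈ QuasiPoly.gE (Fintype.piFinset A) (QuasiPoly.col f)
      (fun b : Fin m → (Fin 2 →₀ ℕ) => ε * QuasiPoly.Xf b + lam * QuasiPoly.Yf b))
    (hj : a j ≠ τ j) :
    (fun i : Fin k => (f i j).coeff (a j) / (f i j).coeff (τ j)) ∉
      Submodule.span ℂ ((fun d : Fin m × (Fin 2 →₀ ℕ) => fun i : Fin k => (f i d.1).coeff d.2 / (f i d.1).coeff (τ d.1)) ''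
        {d' : Fin m × (Fin 2 →₀ ℕ) | d'.2 ∈ A d'.1 ∧ d'.2 ≠ τ d'.1 ∧
          (ε * ((τ d'.1 0 : ℕ) : ℝ) + lam * ((τ d'.1 1 : ℕ) : ℝ)) - (ε * ((d'.2 0 : ℕ) : ℝ) + lam * ((d'.2 1 : ℕ) : ℝ)) <
            (ε * ((τ j 0 : ℕ) : ℝ) + lam * ((τ j 1 : ℕ) : ℝ)) - (ε * ((a j 0 : ℕ) : ℝ) + lam * ((a j 1 : ℕ) : ℝ)) ∧
          (d'.1 = j ∨ a d'.1 = τ d'.1)}) :=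
  Summit.ValiantsHypothesis.ValiantsHypothesis.Theorems.NewtonUnitEquationsDissociatedUniform.stub_torusCrossNovelty
    k m A f ε lam τ a j htorus hτA ha hj

/-- Registered stub T4 = `SubframeCount` — CLOSED (tree theorem `stub_subframeCount`, p134412): if every greedy word met at the injective parameters of `Λ` equals the
word `τ` off a coordinate set `P` and uses only letters from `B j ∋ τ j` (`|B j| ≤ T`), then these words number at most Theorem Q's shadow bound for `P.card` coordinates and `≤ T`
letters: restriction to `P` embeds them into `QuasiPoly.fshadow` of the sub-frame `(B ∘ ι, (f ·) ∘ ι)` (`ι` an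
enumeration of `P`; columns agree up to the constant factor `Π_{j ∉ P} coeff (τ j) (f i j)` — coordinatewise scaling
maps relations to relations, so greediness transfers — heights up to an additive constant), and
`QuasiPoly.ncard_fshadow_le` bounds that shadow. -/
theorem stub_subframeCount (k m T : ℕ) (A : Fin m → Finset (Fin 2 →₀ ℕ))
    (f : Fin k → Fin m → MvPolynomial (Fin 2) ℂ) (ε : ℝ) (Λ : Set ℝ) (τ : Fin m → (Fin 2 →₀ ℕ))
    (P : Finset (Fin m)) (B : Fin m → Finset (Fin 2 →₀ ℕ))
    (hBA : ∀ j, B j ⊆ A j) (hτB : ∀ j, τ j ∈ B j)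
    (hBcard : ∀ j, (B j).card ≤ T)
    (hwords : ∀ lam ∈ Λ, ∀ a : Fin m → (Fin 2 →₀ ℕ),
      Set.InjOn (fun b : Fin m → (Fin 2 →₀ ℕ) => ε * QuasiPoly.Xf b + lam * QuasiPoly.Yf b) (Fintype.piFinset A) →
      a ∈ QuasiPoly.gE (Fintype.piFinset A) (QuasiPoly.col f)
        (fun b : Fin m → (Fin 2 →₀ ℕ) => ε * QuasiPoly.Xf b + lam * QuasiPoly.Yf b) →
      (∀ j, j ∉ P → a j = τ j) ∧ (∀ j, a j ∈ B j)) :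
    {a : Fin m → (Fin 2 →₀ ℕ) | ∃ lam ∈ Λ,
        Set.InjOn (fun b : Fin m → (Fin 2 →₀ ℕ) => ε * QuasiPoly.Xf b + lam * QuasiPoly.Yf b) (Fintype.piFinset A) ∧
        a ∈ QuasiPoly.gE (Fintype.piFinset A) (QuasiPoly.col f)
          (fun b : Fin m → (Fin 2 →₀ ℕ) => ε * QuasiPoly.Xf b + lam * QuasiPoly.Yf b)}.ncard ≤
      (T + 2) * (8 * (k + 2) ^ 3) ^ Nat.clog 2 P.card :=
  Summit.ValiantsHypothesis.ValiantsHypothesis.Theorems.NewtonUnitEquationsDissociatedUniform.stub_subframeCount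
    k m T A f ε Λ τ P B hBA hτB hBcard hwords

end TorusLogK



/-! ## By-product (lead c7): exponent `O(log k)` for ALL dissociated frames — the zero patterns resolved (ALL LANDED)

For an ARBITRARY dissociated frame (structural zeros of the coefficients allowed) every greedy word of a cell has a
GOOD product `i`: it is alive in `i` and differs from the top word `t^i` of product `i`'s alive box in `≤ k − 1`
coordinates (LEMMA Z, `stub_goodProduct` / `stub_zerosDepth`: an elimination induction on the number of products,
replacing the torus-only annihilator trichotomy).  With reference `t^i`, every demotion of an `i`-good greedy word
is a `(2k−2)`-pool element of the DOUBLED colored family in `ℂ^(2k)` (`stub_zerosCrossNovelty`: first block the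
coefficient ratios to the reference letter, second block the raw coefficients on exactly the products where the
reference letter is dead — the doubling makes the target identity exact; fragile coordinates, at most `k`, are
deleted as colors), so by the colored novelty lemma the `i`-good words live on `≤ 4k²` coordinates and the
sub-frame shadow embedding (`stub_subframeShadow`; counted form `stub_subframeCountFilter`) maps them into the shadow
of that sub-frame.  Summing over the `k` references, cells and charts:
`#vert ≤ 2(((m t²)² + 1)·k(4k²+3)(8(k+2)³)^⌈log₂ 4k²⌉ + (m t²)² k) + 2k + 1` for EVERY dissociated frame
(`zeros_logK`, tree `Theorems/…ZerosLogK.lean`), crux shape `(k·m·t + 2)^(10⌈log₂ k⌉ + 21)` (`zeros_logK_cruxShape`):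
the crux holds with exponent `O(log min(k, m))` unconditionally (Theorem Q gives `O(log m)`).
-/

section ZerosLogK

/-- Registered stub Z1 = `GoodProduct` — CLOSED (tree theorem `stub_goodProduct`, p137839, worker of lead c7).
LEMMA Z: if a sum over `S` of rank-one functions `b ↦ x i * ∏ j, v i j (b j)` on a box equals `c·𝟙_a`, `c ≠ 0`,
then some term is alive at `a` with a letter other than `a j` alive in `≤ |S| − 1` coordinates. -/
theorem stub_goodProduct {ι L : Type} [Fintype ι] [DecidableEq ι] [DecidableEq L] (k : ℕ)
    (S : Finset (Fin k)) (U : ι → Finset L) (a : ι → L) (ha : ∀ j, a j ∈ U j)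
    (x : Fin k → ℂ) (v : Fin k → ι → L → ℂ) (c : ℂ) (hc : c ≠ 0)
    (hx : ∀ i ∈ S, x i ≠ 0) (hv : ∀ i ∈ S, ∀ j, ∃ l ∈ U j, v i j l ≠ 0)
    (heq : ∀ b ∈ Fintype.piFinset U, ∑ i ∈ S, x i * ∏ j, v i j (b j) = if b = a then c else 0) :
    ∃ i ∈ S, (∀ j, v i j (a j) ≠ 0) ∧
      (Finset.univ.filter fun j => ∃ l ∈ U j, l ≠ a j ∧ v i j l ≠ 0).card + 1 ≤ S.card :=
  Summit.ValiantsHypothesis.ValiantsHypothesis.Theorems.NewtonUnitEquationsDissociatedUniform.stub_goodProduct k S U a ha x v c hc hx hv heq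

/-- Registered stub Z2 = `ZerosDepth` — CLOSED (tree theorem `stub_zerosDepth`, p137956, lead c7): every greedy
word of every frame is alive in a product in which `≤ k − 1` coordinates carry an alive letter above its own. -/
theorem stub_zerosDepth (k m : ℕ) (A : Fin m → Finset (Fin 2 →₀ ℕ)) (f : Fin k → Fin m → MvPolynomial (Fin 2) ℂ)
    (ε lam : ℝ) (a : Fin m → (Fin 2 →₀ ℕ))
    (hinj : Set.InjOn (fun b : Fin m → (Fin 2 →₀ ℕ) => ε * QuasiPoly.Xf b + lam * QuasiPoly.Yf b) (Fintype.piFinset A))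
    (ha : a ∈ QuasiPoly.gE (Fintype.piFinset A) (QuasiPoly.col f)
      (fun b : Fin m → (Fin 2 →₀ ℕ) => ε * QuasiPoly.Xf b + lam * QuasiPoly.Yf b)) :
    ∃ i : Fin k, (∀ j, (f i j).coeff (a j) ≠ 0) ∧
      (Finset.univ.filter fun j => ∃ l ∈ A j, (f i j).coeff l ≠ 0 ∧
        ε * ((a j 0 : ℕ) : ℝ) + lam * ((a j 1 : ℕ) : ℝ) < ε * ((l 0 : ℕ) : ℝ) + lam * ((l 1 : ℕ) : ℝ)).card + 1 ≤ k :=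
  Summit.ValiantsHypothesis.ValiantsHypothesis.Theorems.NewtonUnitEquationsDissociatedUniform.stub_zerosDepth k m A f ε lam a hinj ha

/-- Registered stub Z3 = `ZerosCrossNovelty` — CLOSED (tree theorem `stub_zerosCrossNovelty`, p137825, worker of
lead c7): the doubled coefficient vector of a demotion of a greedy word is novel among the lighter doubled vectors
on its own coordinate or on non-fragile coordinates where the word agrees with the reference. -/
theorem stub_zerosCrossNovelty (k m : ℕ) (A : Fin m → Finset (Fin 2 →₀ ℕ))
    (f : Fin k → Fin m → MvPolynomial (Fin 2) ℂ) (ε lam : ℝ) (τ a : Fin m → (Fin 2 →₀ ℕ)) (j : Fin m)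
    (hτA : ∀ j, τ j ∈ A j)
    (ha : a ∈ QuasiPoly.gE (Fintype.piFinset A) (QuasiPoly.col f)
      (fun b : Fin m → (Fin 2 →₀ ℕ) => ε * QuasiPoly.Xf b + lam * QuasiPoly.Yf b))
    (hj : a j ≠ τ j) :
    (fun p : Fin 2 × Fin k => if p.1 = 0 then (f p.2 j).coeff (a j) / (f p.2 j).coeff (τ j)
        else (if (f p.2 j).coeff (τ j) = 0 then (f p.2 j).coeff (a j) else 0)) ∉
      Submodule.span ℂ ((fun d : Fin m × (Fin 2 →₀ ℕ) => fun p : Fin 2 × Fin k =>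
          if p.1 = 0 then (f p.2 d.1).coeff d.2 / (f p.2 d.1).coeff (τ d.1)
          else (if (f p.2 d.1).coeff (τ d.1) = 0 then (f p.2 d.1).coeff d.2 else 0)) ''
        {d' : Fin m × (Fin 2 →₀ ℕ) | d'.2 ∈ A d'.1 ∧ d'.2 ≠ τ d'.1 ∧
          (ε * ((τ d'.1 0 : ℕ) : ℝ) + lam * ((τ d'.1 1 : ℕ) : ℝ)) - (ε * ((d'.2 0 : ℕ) : ℝ) + lam * ((d'.2 1 : ℕ) : ℝ)) <
            (ε * ((τ j 0 : ℕ) : ℝ) + lam * ((τ j 1 : ℕ) : ℝ)) - (ε * ((a j 0 : ℕ) : ℝ) + lam * ((a j 1 : ℕ) : ℝ)) ∧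
          (d'.1 = j ∨ (a d'.1 = τ d'.1 ∧ ¬ ∃ i' : Fin k, (f i' d'.1).coeff (τ d'.1) = 0 ∧
              ∀ j'', j'' ≠ d'.1 → (f i' j'').coeff (Function.update a j (τ j) j'') ≠ 0))}) :=
  Summit.ValiantsHypothesis.ValiantsHypothesis.Theorems.NewtonUnitEquationsDissociatedUniform.stub_zerosCrossNovelty k m A f ε lam τ a j hτA ha hj

/-- Registered stub Z4 = `SubframeCountFilter` — CLOSED (tree theorem `stub_subframeCountFilter`, p137657, worker
of lead c7): the greedy words of the cell that agree with `τ` off `P` and use letters of `B j` only number at most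
`(T + 2)(8(k+2)³)^⌈log₂ |P|⌉`. -/
theorem stub_subframeCountFilter (k m T : ℕ) (A : Fin m → Finset (Fin 2 →₀ ℕ))
    (f : Fin k → Fin m → MvPolynomial (Fin 2) ℂ) (ε : ℝ) (Λ : Set ℝ) (τ : Fin m → (Fin 2 →₀ ℕ))
    (P : Finset (Fin m)) (B : Fin m → Finset (Fin 2 →₀ ℕ))
    (hBA : ∀ j, B j ⊆ A j) (hτB : ∀ j, τ j ∈ B j) (hBcard : ∀ j, (B j).card ≤ T) :
    {a : Fin m → (Fin 2 →₀ ℕ) | (∃ lam ∈ Λ,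
        Set.InjOn (fun b : Fin m → (Fin 2 →₀ ℕ) => ε * QuasiPoly.Xf b + lam * QuasiPoly.Yf b) (Fintype.piFinset A) ∧
        a ∈ QuasiPoly.gE (Fintype.piFinset A) (QuasiPoly.col f)
          (fun b : Fin m → (Fin 2 →₀ ℕ) => ε * QuasiPoly.Xf b + lam * QuasiPoly.Yf b)) ∧
        (∀ j, j ∉ P → a j = τ j) ∧ (∀ j, a j ∈ B j)}.ncard ≤
      (T + 2) * (8 * (k + 2) ^ 3) ^ Nat.clog 2 P.card :=
  Summit.ValiantsHypothesis.ValiantsHypothesis.Theorems.NewtonUnitEquationsDissociatedUniform.stub_subframeCountFilter k m T A f ε Λ τ P B hBA hτB hBcard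

/-- Registered stub Z5 = `SubframeShadow` — CLOSED (tree theorem `stub_subframeShadow`, p138129, lead c7): the
bound-free form of Z4 — any uniform bound `Q` on the shadows of the `k`-product frames on `Fin |P|` with `≤ T`
letters bounds the same word set by `Q`. -/
theorem stub_subframeShadow (k m T Q : ℕ) (A : Fin m → Finset (Fin 2 →₀ ℕ))
    (f : Fin k → Fin m → MvPolynomial (Fin 2) ℂ) (ε : ℝ) (Λ : Set ℝ) (τ : Fin m → (Fin 2 →₀ ℕ))
    (P : Finset (Fin m)) (B : Fin m → Finset (Fin 2 →₀ ℕ))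
    (hBA : ∀ j, B j ⊆ A j) (hτB : ∀ j, τ j ∈ B j) (hBcard : ∀ j, (B j).card ≤ T)
    (hQ : ∀ (A' : Fin P.card → Finset (Fin 2 →₀ ℕ)) (f' : Fin k → Fin P.card → MvPolynomial (Fin 2) ℂ),
      (∀ i, (A' i).card ≤ T) → (QuasiPoly.fshadow A' f').ncard ≤ Q) :
    {a : Fin m → (Fin 2 →₀ ℕ) | (∃ lam ∈ Λ,
        Set.InjOn (fun b : Fin m → (Fin 2 →₀ ℕ) => ε * QuasiPoly.Xf b + lam * QuasiPoly.Yf b) (Fintype.piFinset A) ∧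
        a ∈ QuasiPoly.gE (Fintype.piFinset A) (QuasiPoly.col f)
          (fun b : Fin m → (Fin 2 →₀ ℕ) => ε * QuasiPoly.Xf b + lam * QuasiPoly.Yf b)) ∧
        (∀ j, j ∉ P → a j = τ j) ∧ (∀ j, a j ∈ B j)}.ncard ≤ Q :=
  Summit.ValiantsHypothesis.ValiantsHypothesis.Theorems.NewtonUnitEquationsDissociatedUniform.stub_subframeShadow k m T Q A f ε Λ τ P B hBA hτB hBcard hQ

/-- Registered by-product stub `zeros_perCell_of_bound` — CLOSED (tree theorem, file `…ZerosLogKCell.lean`, p138668,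
lead c7): the per-cell KERNEL REDUCTION — any uniform bound `Q` on the shadows of `k`-product frames with `≤ 4k²`
coordinates and `≤ 4k² + 1` letters bounds the greedy words of a cell of an ARBITRARY frame by `k·Q`. -/
theorem zeros_perCell_of_bound (k m Q : ℕ) (A : Fin m → Finset (Fin 2 →₀ ℕ)) (f : Fin k → Fin m → MvPolynomial (Fin 2) ℂ) (ε : ℝ) (Λ : Set ℝ) (hQ : ∀ n : ℕ, n ≤ 4 * k ^ 2 → ∀ (A' : Fin n → Finset (Fin 2 →₀ ℕ)) (f' : Fin k → Fin n → MvPolynomial (Fin 2) ℂ), (∀ i, (A' i).card ≤ 4 * k ^ 2 + 1) → (QuasiPoly.fshadow A' f').ncard ≤ Q) (hcell : ∀ (j j' : Fin m), ∀ l₁ ∈ A j, ∀ l₂ ∈ A j, ∀ l₃ ∈ A j', ∀ l₄ ∈ A j', ∀ lam ∈ Λ, ∀ lam' ∈ Λ, ((ε * ((((l₁ 0 : ℕ) : ℝ)) - (((l₂ 0 : ℕ) : ℝ)) - (((l₃ 0 : ℕ) : ℝ)) + (((l₄ 0 : ℕ) : ℝ))) + lam * ((((l₁ 1 : ℕ)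 : ℝ)) - (((l₂ 1 : ℕ) : ℝ)) - (((l₃ 1 : ℕ) : ℝ)) + (((l₄ 1 : ℕ) : ℝ))) < 0 ↔ ε * ((((l₁ 0 : ℕ) : ℝ)) - (((l₂ 0 : ℕ) : ℝ)) - (((l₃ 0 : ℕ) : ℝ)) + (((l₄ 0 : ℕ) : ℝ))) + lam' * ((((l₁ 1 : ℕ) : ℝ)) - (((l₂ 1 : ℕ) : ℝ)) - (((l₃ 1 : ℕ) : ℝ)) + (((l₄ 1 : ℕ) : ℝ))) < 0) ∧ (0 < ε * ((((l₁ 0 : ℕ) : ℝ)) - (((l₂ 0 : ℕ) : ℝ)) - (((l₃ 0 : ℕ) : ℝ)) + (((l₄ 0 : ℕ) : ℝ))) + lam * ((((l₁ 1 : ℕ) : ℝ)) - (((l₂ 1 : ℕ) : ℝ)) - (((l₃ 1 : ℕ) : ℝ)) + (((l₄ 1 : ℕ) : ℝ))) ↔ 0 < ε * ((((l₁ 0 : ℕ) : ℝ)) - (((l₂ 0 : ℕ) : ℝ)) - (((l₃ 0 : ℕ) : ℝ)) + (((l₄ 0 : ℕ) : ℝ))) + lam' * ((((l₁ 1 : ℕ)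 : ℝ)) - (((l₂ 1 : ℕ) : ℝ)) - (((l₃ 1 : ℕ) : ℝ)) + (((l₄ 1 : ℕ) : ℝ)))))) : {a : Fin m → (Fin 2 →₀ ℕ) | ∃ lam ∈ Λ, Set.InjOn (fun b : Fin m → (Fin 2 →₀ ℕ) => ε * QuasiPoly.Xf b + lam * QuasiPoly.Yf b) (Fintype.piFinset A) ∧ a ∈ QuasiPoly.gE (Fintype.piFinset A) (QuasiPoly.col f) (fun b : Fin m → (Fin 2 →₀ ℕ) => ε * QuasiPoly.Xf b + lam * QuasiPoly.Yf b)}.ncard ≤ k * Q :=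
  Summit.ValiantsHypothesis.ValiantsHypothesis.Theorems.NewtonUnitEquationsDissociatedUniform.zeros_perCell_of_bound k m Q A f ε Λ hQ hcell

/-- Registered by-product stub `zeros_perCell` — CLOSED (tree theorem, file `…ZerosLogKCell.lean`, p138668, lead c7): per
cell, the greedy words of an ARBITRARY frame number `≤ k·(4k² + 3)(8(k+2)³)^⌈log₂ 4k²⌉` (Theorem-Q form of the reduction). -/
theorem zeros_perCell (k m : ℕ) (A : Fin m → Finset (Fin 2 →₀ ℕ)) (f : Fin k → Fin m → MvPolynomial (Fin 2) ℂ) (ε : ℝ) (Λ : Set ℝ) (hcell : ∀ (j j' : Fin m), ∀ l₁ ∈ A j, ∀ l₂ ∈ A j, ∀ l₃ ∈ A j', ∀ l₄ ∈ A j', ∀ lam ∈ Λ, ∀ lam' ∈ Λ, ((ε * ((((l₁ 0 : ℕ) : ℝ)) - (((l₂ 0 : ℕ) : ℝ)) - (((l₃ 0 : ℕ) : ℝ)) + (((l₄ 0 : ℕ) : ℝ))) + lam * ((((l₁ 1 : ℕ) : ℝ)) - (((l₂ 1 : ℕ) : ℝ)) - (((l₃ 1 : ℕ) : ℝ)) +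 (((l₄ 1 : ℕ) : ℝ))) < 0 ↔ ε * ((((l₁ 0 : ℕ) : ℝ)) - (((l₂ 0 : ℕ) : ℝ)) - (((l₃ 0 : ℕ) : ℝ)) + (((l₄ 0 : ℕ) : ℝ))) + lam' * ((((l₁ 1 : ℕ) : ℝ)) - (((l₂ 1 : ℕ) : ℝ)) - (((l₃ 1 : ℕ) : ℝ)) + (((l₄ 1 : ℕ) : ℝ))) < 0) ∧ (0 < ε * ((((l₁ 0 : ℕ) : ℝ)) - (((l₂ 0 : ℕ) : ℝ)) - (((l₃ 0 : ℕ) : ℝ)) + (((l₄ 0 : ℕ) : ℝ))) + lam * ((((l₁ 1 : ℕ) : ℝ)) - (((l₂ 1 : ℕ) : ℝ)) - (((l₃ 1 : ℕ) : ℝ)) + (((l₄ 1 : ℕ) : ℝ))) ↔ 0 < ε * ((((l₁ 0 : ℕ) : ℝ)) - (((l₂ 0 : ℕ) : ℝ)) - (((l₃ 0 : ℕ) : ℝ)) + (((l₄ 0 : ℕ) : ℝ))) + lam' * ((((l₁ 1 : ℕ) : ℝ)) - (((l₂ 1 : ℕ) : ℝ)) - (((l₃ 1 : ℕ) : ℝ))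 + (((l₄ 1 : ℕ) : ℝ)))))) : {a : Fin m → (Fin 2 →₀ ℕ) | ∃ lam ∈ Λ, Set.InjOn (fun b : Fin m → (Fin 2 →₀ ℕ) => ε * QuasiPoly.Xf b + lam * QuasiPoly.Yf b) (Fintype.piFinset A) ∧ a ∈ QuasiPoly.gE (Fintype.piFinset A) (QuasiPoly.col f) (fun b : Fin m → (Fin 2 →₀ ℕ) => ε * QuasiPoly.Xf b + lam * QuasiPoly.Yf b)}.ncard ≤ k * ((4 * k ^ 2 + 3) * (8 * (k + 2) ^ 3) ^ Nat.clog 2 (4 * k ^ 2)) :=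
  Summit.ValiantsHypothesis.ValiantsHypothesis.Theorems.NewtonUnitEquationsDissociatedUniform.zeros_perCell k m A f ε Λ hcell

/-- Registered by-product stub `zeros_logK` — CLOSED (tree theorem `zeros_logK`, file `…ZerosLogK.lean`, lead c7):
exponent `O(log k)` for ALL dissociated frames. -/
theorem zeros_logK (k m t : ℕ) (A : Fin m → Finset (Fin 2 →₀ ℕ)) (f : Fin k → Fin m → MvPolynomial (Fin 2) ℂ)
    (hcard : ∀ j, (A j).card ≤ t) (hsupp : ∀ i j, (f i j).support ⊆ A j)
    (hdis : ∀ a b : Fin m → (Fin 2 →₀ ℕ), (∀ j, a j ∈ A j) → (∀ j, b j ∈ A j) → ∑ j, a j = ∑ j, b j → a = b) :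
    (Set.extremePoints ℝ (convexHull ℝ ((fun e : Fin 2 →₀ ℕ => fun i : Fin 2 => ((e i : ℕ) : ℝ)) ''
      ((∑ i, ∏ j, f i j).support : Set (Fin 2 →₀ ℕ))))).ncard ≤
      2 * (((m * t ^ 2) ^ 2 + 1) * (k * ((4 * k ^ 2 + 3) * (8 * (k + 2) ^ 3) ^ Nat.clog 2 (4 * k ^ 2))) +
        (m * t ^ 2) ^ 2 * k) + k + k + 1 :=
  Summit.ValiantsHypothesis.ValiantsHypothesis.Theorems.NewtonUnitEquationsDissociatedUniform.zeros_logK k m t A f hcard hsupp hdis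

/-- Registered by-product stub `zeros_logK_cruxShape` — CLOSED (tree theorem, lead c7): on every dissociated frame
`#vert ≤ (k·m·t + 2)^(10⌈log₂ k⌉ + 21)`, i.e. `DissociatedUniform` with exponent `O(log k)` (hence `O(log min(k,m))`
with Theorem Q) and NO hypothesis on the coefficients. -/
theorem zeros_logK_cruxShape (k m t : ℕ) (A : Fin m → Finset (Fin 2 →₀ ℕ))
    (f : Fin k → Fin m → MvPolynomial (Fin 2) ℂ) (hcard : ∀ j, (A j).card ≤ t)
    (hsupp : ∀ i j, (f i j).support ⊆ A j)
    (hdis : ∀ a b : Fin m → (Fin 2 →₀ ℕ), (∀ j, a j ∈ A j) → (∀ j, b j ∈ A j) → ∑ j, a j = ∑ j, b j → a = b) :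
    (Set.extremePoints ℝ (convexHull ℝ ((fun e : Fin 2 →₀ ℕ => fun i : Fin 2 => ((e i : ℕ) : ℝ)) ''
      ((∑ i, ∏ j, f i j).support : Set (Fin 2 →₀ ℕ))))).ncard ≤ (k * m * t + 2) ^ (10 * Nat.clog 2 k + 21) :=
  Summit.ValiantsHypothesis.ValiantsHypothesis.Theorems.NewtonUnitEquationsDissociatedUniform.zeros_logK_cruxShape k m t A f hcard hsupp hdis

end ZerosLogK

end Summit.ValiantsHypothesis.ValiantsHypothesis.Cruxes.DissociatedUniform.GreedyBasisShadow
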